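import Literature.NumberTheory.EllipticCurves.KramerCurves
import Literature.NumberTheory.EllipticCurves.PAdicHeights
import Literature.NumberTheory.DiophantineGeometry.LocalReductionProofs
import HarnessLib

/-!
# Kramer's curve `A_m` over `ℚ_q` at a prime `q ∣ m`: split multiplicative reduction (proved)

For Kramer's curve `A_m : y² + xy = x³ + 8m x² + m(16m + 1) x` (K. Kramer, Proc. AMS 89 (1983),
(11); K. Matsuno, Math. Res. Lett. 16 (2009), (5), with `l = 16m + 1`) and a prime `q` dividing
the integer `m ≠ 0`, this file PROVES that `A_m` has split multiplicative reduction at `q` in the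
`p`-adic spelling of the tree (`WeierstrassCurve.HasSplitMultiplicativeReductionAtPrime`, file
`PAdicHeights`: Mathlib's `HasSplitMultiplicativeReduction` for the `ℤ_q`-minimal model
`(A_m/ℚ_q).minimal ℤ_q`). This is the reduction-type half of the local input of Matsuno's
Corollary 5.6 (`Literature.NumberTheory.EllipticCurves.Matsuno2009_curveA_tamagawa`, file
`MatsunoCurvesRank`: "If `m_j` does not divide `st`, then the Tamagawa factor of `A` at `m_j`
is equal to `2n`, i.e., `m_j ∈ T_{A,K}`"; and p. 458: "both `A` and `B` have split
multiplicative reduction at `q`"), i.e. hypothesis (i) of Matsuno's Lemma 4.1 at the `m_j`.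

The computation: the integral equation has `c₄ = 16 m(16m+1) + 1 ≡ 1 (mod q)`, a `q`-adic unit,
so it is minimal at `q` (an integral equation with unit `c₄` is minimal — Silverman, *AEC*,
VII.1, Remark 1.1 — proved here over any discrete valuation ring,
`WeierstrassCurve.isMinimal_of_valuation_c₄_eq_one`) with multiplicative reduction
(`Δ = m²(16m+1)² ≡ 0`); its reduction is `y² + xy = x³`, whose node `(0,0)` has the rational
tangents `y = 0`, `y = −x`: Mathlib's node-tangent polynomial
`c₄ T² + a₁c₄ T − (54 b₆ − 3 b₂ b₄ + a₂ c₄)` reduces to `T² + T = T(T + 1)`, which splits. Split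
multiplicative reduction then passes to Mathlib's chosen minimal model by the tree's
`hasSplitMultiplicativeReduction_iff_of_isMinimal_of_eq_smul` (`LocalReductionProofs`).

## References

* [Kramer1983] K. Kramer, Proc. Amer. Math. Soc. 89 (1983), 379–386, Lemma 1 and §5 (p. 383).
* [Matsuno2009] K. Matsuno, Math. Res. Lett. 16 (2009), 449–461, §5 (5) and p. 458.
* [SilvermanAEC2009] J. H. Silverman, *The Arithmetic of Elliptic Curves*, 2nd ed., VII.1
  Remark 1.1, VII.5 Prop. 5.1.
-/

noncomputable section

open scoped Classical

open IsLocalRing Polynomial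

namespace WeierstrassCurve

/-! ### An integral equation with unit `c₄` is minimal (any DVR) -/

section DVR

variable {R : Type*} [CommRing R] [IsDomain R] [IsDiscreteValuationRing R]
  {K : Type*} [Field K] [Algebra R K] [IsFractionRing R K]

/-- The valuation ring of the adic valuation of the maximal ideal of a DVR `R` on `K = Frac R`
is `R` (Mathlib's `IsDiscreteValuationRing.exists_lift_of_le_one`), in the form consumed by the
tree's `isMinimal_iff_of_le_one_iff`. [folklore] -/
theorem valuation_maximalIdeal_le_one_iff_mem_range (x : K) :
    (IsDiscreteValuationRing.maximalIdeal R).valuation K x ≤ 1 ↔ x ∈ (algebraMap R K).range :=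
  ⟨fun h => IsDiscreteValuationRing.exists_lift_of_le_one h,
    fun ⟨r, hr⟩ => hr ▸ IsDedekindDomain.HeightOneSpectrum.valuation_le_one _ r⟩

/-- **An integral Weierstrass equation with unit `c₄` is minimal** over a discrete valuation ring
(Silverman, *AEC*, VII.1, Remark 1.1: `v(c₄) < 4` suffices; here `v(c₄) = 0`): for any change of
variables `C` with `C • W` integral, `c₄(C • W) = u⁻⁴ c₄(W)` is integral, so `v(u⁻¹) ≤ 1` and
`v(Δ(C • W)) = v(u⁻¹)¹² v(Δ(W)) ≤ v(Δ(W))`. (Dot-notation extension of Mathlib's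
`WeierstrassCurve`; the place-indexed version is the tree's `isMinimalAt_of_valuation_c₄_eq_one`.)
[cite: SilvermanAEC2009, VII.1 Remark 1.1] -/
theorem isMinimal_of_valuation_c₄_eq_one (W : WeierstrassCurve K) [W.IsIntegral R]
    (h : (IsDiscreteValuationRing.maximalIdeal R).valuation K W.c₄ = 1) : W.IsMinimal R := by
  rw [isMinimal_iff_of_le_one_iff (valuation_maximalIdeal_le_one_iff_mem_range (R := R)) W]
  refine ⟨inferInstance, fun C hC => ?_⟩
  set V := (IsDiscreteValuationRing.maximalIdeal R).valuation K with hV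
  haveI := hC
  have hc : V (C • W).c₄ ≤ 1 :=
    (valuation_maximalIdeal_le_one_iff_mem_range _).mpr ⟨_, integralModel_c₄_eq R (C • W)⟩
  rw [variableChange_c₄, Valuation.map_mul, Valuation.map_pow, h, mul_one] at hc
  have hu : V (↑C.u⁻¹ : K) ≤ 1 := (pow_le_one_iff (by norm_num)).mp hc
  rw [variableChange_Δ, Valuation.map_mul, Valuation.map_pow]
  exact mul_le_of_le_one_left zero_le (pow_le_one₀ zero_le hu)

end DVR

end WeierstrassCurve

namespace Literature.NumberTheory.EllipticCurves

open WeierstrassCurve IsDedekindDomain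

/-! ### Kramer's curve `A_m` over `ℚ_q`, `q ∣ m` -/

section Padic

variable (q : ℕ) [Fact q.Prime]

/-- `A_m ⊗ ℚ_q` is the base change of the `ℤ_q`-integral equation `A_m/ℤ_q`. [folklore] -/
theorem baseChange_kramerCurveA_padicInt (m : ℤ) :
    (kramerCurveA (m : ℤ_[q])).baseChange ℚ_[q] = kramerCurveA (m : ℚ_[q]) := by
  rw [baseChange, map_kramerCurveA, map_intCast]

/-- `(A_m/ℚ) ⊗ ℚ_q = A_m/ℚ_q`. [folklore] -/
theorem baseChange_padic_kramerCurveA_rat (m : ℤ) :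
    (kramerCurveA (m : ℚ)).baseChange ℚ_[q] = kramerCurveA (m : ℚ_[q]) := by
  rw [baseChange, map_kramerCurveA, map_intCast]

/-- `A_m/ℚ_q` is `ℤ_q`-integral (a theorem, used via `haveI`, to keep this file free of
definitions). [folklore] -/
theorem isIntegral_kramerCurveA_padic (m : ℤ) : (kramerCurveA (m : ℚ_[q])).IsIntegral ℤ_[q] :=
  ⟨⟨kramerCurveA (m : ℤ_[q]), (baseChange_kramerCurveA_padicInt q m).symm⟩⟩

/-- Mathlib's integral model of `A_m/ℚ_q` is the equation `A_m/ℤ_q` itself (base change along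
the injective `ℤ_q → ℚ_q` is injective on Weierstrass equations). [folklore] -/
theorem integralModel_kramerCurveA_padic (m : ℤ) :
    haveI := isIntegral_kramerCurveA_padic q m
    (kramerCurveA (m : ℚ_[q])).integralModel ℤ_[q] = kramerCurveA (m : ℤ_[q]) := by
  haveI := isIntegral_kramerCurveA_padic q m
  apply WeierstrassCurve.map_injective (f := algebraMap ℤ_[q] ℚ_[q]) (IsFractionRing.injective _ _)
  change ((kramerCurveA (m : ℚ_[q])).integralModel ℤ_[q]).baseChange ℚ_[q] =
    (kramerCurveA (m : ℤ_[q])).baseChange ℚ_[q]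
  rw [baseChange_integralModel_eq, baseChange_kramerCurveA_padicInt]

variable {q}

/-- If `q ∣ m` then `m ∈ 𝔪_{ℤ_q}`. [folklore] -/
theorem intCast_mem_maximalIdeal_padicInt {m : ℤ} (hqm : (q : ℤ) ∣ m) :
    (m : ℤ_[q]) ∈ maximalIdeal ℤ_[q] := by
  rw [PadicInt.maximalIdeal_eq_span_p, Ideal.mem_span_singleton]
  obtain ⟨c, rfl⟩ := hqm
  exact ⟨(c : ℤ_[q]), by push_cast; ring⟩

/-- `c₄(A_m) = 16 m(16m+1) + 1` is a `q`-adic unit for `q ∣ m`. [folklore] -/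
theorem c₄_kramerCurveA_not_mem_maximalIdeal {m : ℤ} (hqm : (q : ℤ) ∣ m) :
    (kramerCurveA (m : ℤ_[q])).c₄ ∉ maximalIdeal ℤ_[q] := by
  intro h
  have hm := intCast_mem_maximalIdeal_padicInt hqm
  have h1 : (1 : ℤ_[q]) ∈ maximalIdeal ℤ_[q] := by
    have e : (1 : ℤ_[q]) = (kramerCurveA (m : ℤ_[q])).c₄ -
        16 * ((16 * (m : ℤ_[q]) + 1)) * (m : ℤ_[q]) := by
      rw [kramerCurveA_c₄]; ring
    rw [e]
    exact Ideal.sub_mem _ h (Ideal.mul_mem_left _ _ hm)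
  exact (maximalIdeal.isMaximal ℤ_[q]).ne_top ((Ideal.eq_top_iff_one _).mpr h1)

/-- `Δ(A_m) = m²(16m+1)² ∈ 𝔪_{ℤ_q}` for `q ∣ m`. [folklore] -/
theorem Δ_kramerCurveA_mem_maximalIdeal {m : ℤ} (hqm : (q : ℤ) ∣ m) :
    (kramerCurveA (m : ℤ_[q])).Δ ∈ maximalIdeal ℤ_[q] := by
  rw [kramerCurveA_Δ]
  exact Ideal.mul_mem_right _ _
    (Ideal.pow_mem_of_mem _ (intCast_mem_maximalIdeal_padicInt hqm) 2 two_pos)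

/-- `v_q(c₄(A_m/ℚ_q)) = 1` (unit `c₄`) for `q ∣ m`. [folklore] -/
theorem valuation_c₄_kramerCurveA_padic {m : ℤ} (hqm : (q : ℤ) ∣ m) :
    (IsDiscreteValuationRing.maximalIdeal ℤ_[q]).valuation ℚ_[q] (kramerCurveA (m : ℚ_[q])).c₄
      = 1 := by
  rw [← baseChange_kramerCurveA_padicInt, baseChange, map_c₄,
    HeightOneSpectrum.valuation_eq_one_iff_notMem]
  exact c₄_kramerCurveA_not_mem_maximalIdeal hqm

/-- `v_q(Δ(A_m/ℚ_q)) < 1` for `q ∣ m`. [folklore] -/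
theorem valuation_Δ_kramerCurveA_padic {m : ℤ} (hqm : (q : ℤ) ∣ m) :
    (IsDiscreteValuationRing.maximalIdeal ℤ_[q]).valuation ℚ_[q] (kramerCurveA (m : ℚ_[q])).Δ
      < 1 := by
  rw [← baseChange_kramerCurveA_padicInt, baseChange, map_Δ,
    HeightOneSpectrum.valuation_lt_one_iff_mem]
  exact Δ_kramerCurveA_mem_maximalIdeal hqm

/-- **`A_m/ℚ_q` is a minimal equation at `q ∣ m`** (unit `c₄`). [cite: Kramer1983, Lemma 1] -/
theorem isMinimal_kramerCurveA_padic {m : ℤ} (hqm : (q : ℤ) ∣ m) :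
    (kramerCurveA (m : ℚ_[q])).IsMinimal ℤ_[q] :=
  haveI := isIntegral_kramerCurveA_padic q m
  isMinimal_of_valuation_c₄_eq_one _ (valuation_c₄_kramerCurveA_padic hqm)

/-- **`A_m/ℚ_q` has multiplicative reduction at `q ∣ m`** (`v(Δ) > 0`, `v(c₄) = 0`; "By Lemma 1,
`A` is semistable", Kramer p. 383). [cite: Kramer1983, Lemma 1 and §5 (p. 383)] -/
theorem hasMultiplicativeReduction_kramerCurveA_padic {m : ℤ} (hqm : (q : ℤ) ∣ m) :
    (kramerCurveA (m : ℚ_[q])).HasMultiplicativeReduction ℤ_[q] :=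
  haveI := isMinimal_kramerCurveA_padic hqm
  { badReduction := valuation_Δ_kramerCurveA_padic hqm
    multiplicativeReduction := valuation_c₄_kramerCurveA_padic hqm }

/-- The node-tangent polynomial of `A_m/ℤ_q` reduces to `T² + T` modulo `q ∣ m`
(`c₄ ≡ 1`, `a₁ = 1`, `b₆ = 0`, `b₄ = 2m(16m+1) ≡ 0`, `a₂ = 8m ≡ 0`): the tangents at the node
`(0,0)` of `y² + xy = x³` are `y = 0` and `y = −x`. [folklore] -/
theorem nodalTangents_kramerCurveA_padic {m : ℤ} (hqm : (q : ℤ) ∣ m) :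
    letI I := kramerCurveA (m : ℤ_[q])
    Polynomial.map (algebraMap ℤ_[q] (ResidueField ℤ_[q]))
      (C I.c₄ * X ^ 2 + C (I.a₁ * I.c₄) * X - C (54 * I.b₆ - 3 * I.b₂ * I.b₄ + I.a₂ * I.c₄)) =
      X ^ 2 + X := by
  set I := kramerCurveA (m : ℤ_[q]) with hI
  set f := algebraMap ℤ_[q] (ResidueField ℤ_[q]) with hf
  have hm : f (m : ℤ_[q]) = 0 := by
    rw [hf, IsLocalRing.ResidueField.algebraMap_eq, residue_eq_zero_iff]
    exact intCast_mem_maximalIdeal_padicInt hqm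
  have ha₁ : I.a₁ = 1 := rfl
  have ha₂ : I.a₂ = 8 * (m : ℤ_[q]) := rfl
  have hb₆ : I.b₆ = 0 := by simp [hI, kramerCurveA, WeierstrassCurve.b₆]
  have hb₄ : I.b₄ = (m : ℤ_[q]) * (2 * (16 * (m : ℤ_[q]) + 1)) := by
    simp [hI, kramerCurveA, WeierstrassCurve.b₄]; ring
  have e1 : f I.c₄ = 1 := by
    rw [hI, kramerCurveA_c₄, map_add, map_mul, map_mul, hm, zero_mul, mul_zero, zero_add,
      map_one]
  have e2 : f (I.a₁ * I.c₄) = 1 := by rw [ha₁, one_mul, e1]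
  have e3 : f (54 * I.b₆ - 3 * I.b₂ * I.b₄ + I.a₂ * I.c₄) = 0 := by
    have e : 54 * I.b₆ - 3 * I.b₂ * I.b₄ + I.a₂ * I.c₄ =
        (m : ℤ_[q]) * (8 * I.c₄ - 3 * I.b₂ * (2 * (16 * (m : ℤ_[q]) + 1))) := by
      rw [hb₆, hb₄, ha₂]; ring
    rw [e, map_mul, hm, zero_mul]
  rw [Polynomial.map_sub, Polynomial.map_add, Polynomial.map_mul, Polynomial.map_mul,
    Polynomial.map_pow, Polynomial.map_C, Polynomial.map_C, Polynomial.map_C, Polynomial.map_X,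
    e1, e2, e3, map_one, map_zero, one_mul, one_mul, sub_zero]

/-- **`A_m/ℚ_q` has split multiplicative reduction at `q ∣ m`** (the equation itself; "both
`A` and `B` have split multiplicative reduction at `q`", Matsuno p. 458, for `q = m_j`).
[cite: Matsuno2009, §5 (p. 458)] -/
theorem hasSplitMultiplicativeReduction_kramerCurveA_padic {m : ℤ} (hqm : (q : ℤ) ∣ m) :
    (kramerCurveA (m : ℚ_[q])).HasSplitMultiplicativeReduction ℤ_[q] := by
  haveI := hasMultiplicativeReduction_kramerCurveA_padic hqm
  refine ⟨?_⟩
  rw [integralModel_kramerCurveA_padic]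
  change Splits (Polynomial.map (algebraMap ℤ_[q] (ResidueField ℤ_[q])) _)
  rw [nodalTangents_kramerCurveA_padic hqm,
    show (X ^ 2 + X : (ResidueField ℤ_[q])[X]) = X * (X + C 1) by rw [map_one]; ring]
  exact Splits.X.mul (Splits.X_add_C 1)

/-- **`A_m` has split multiplicative reduction at every prime `q ∣ m`** (`m ≠ 0`), in the
tree's `p`-adic spelling `WeierstrassCurve.HasSplitMultiplicativeReductionAtPrime` (Mathlib's
chosen `ℤ_q`-minimal model of `A_m/ℚ_q`; transfer from the equation `A_m/ℚ_q`, which is itself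
minimal, by `hasSplitMultiplicativeReduction_iff_of_isMinimal_of_eq_smul`). This is hypothesis
(i) of Matsuno's Lemma 4.1 for `A` at the primes `m_j` (p. 458).
[cite: Matsuno2009, §5 (p. 458) with Lemma 4.1 (i)] -/
theorem hasSplitMultiplicativeReductionAtPrime_kramerCurveA {m : ℤ} (hm : m ≠ 0)
    (hqm : (q : ℤ) ∣ m) : (kramerCurveA (m : ℚ)).HasSplitMultiplicativeReductionAtPrime q := by
  unfold HasSplitMultiplicativeReductionAtPrime
  rw [baseChange_padic_kramerCurveA_rat]
  set X : WeierstrassCurve ℚ_[q] := kramerCurveA (m : ℚ_[q]) with hX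
  haveI : X.IsMinimal ℤ_[q] := isMinimal_kramerCurveA_padic hqm
  have hmin : X.minimal ℤ_[q] = (X.exists_isMinimal ℤ_[q]).choose • X := rfl
  have hΔ : X.Δ ≠ 0 := by
    rw [hX, kramerCurveA_Δ]
    have hm' : (m : ℚ_[q]) ≠ 0 := by exact_mod_cast hm
    have hl' : (16 * (m : ℚ_[q]) + 1) ≠ 0 := by exact_mod_cast sixteen_mul_add_one_ne_zero m
    exact mul_ne_zero (pow_ne_zero _ hm') (pow_ne_zero _ hl')
  exact (hasSplitMultiplicativeReduction_iff_of_isMinimal_of_eq_smul ℤ_[q] hmin hΔ).mpr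
    (hasSplitMultiplicativeReduction_kramerCurveA_padic hqm)

end Padic

end Literature.NumberTheory.EllipticCurves

end
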